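import Summits.CriticalPhenomena.PercolationContinuityZ3.Theorems.PercNearOneGluingNoHeavyQuantGateMoveBlobHeavyData
import Summits.CriticalPhenomena.PercolationContinuityZ3.Theorems.PercNearOneGluingNoHeavyQuantLightTwoBlobDEC
import HarnessLib

/-!
# QUANT lane R8, T-DEC, leg (III): the maximal ONE-LAYER branch of the blob gate move / window form CW — a datum of the partner at the layer `j`
# WITHOUT LIGHT STRADDLERS (`BValidAt`) whose zero rides giants: **`decAtT_gateMoveBlob_of_bdecDatum`**, **`windowMix_of_bdecDatum`**

builds on p205010 (kernel theorem, internal audit signed; external expert review pending)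

Support file (`--supports stmt-CriticalPhenomena-4575`), QUANT lane seat prim-quant-arm-1 (gen 40), rung R8 of
`run/shared/lean/prim/quant/LADDER.md`.  Theorems only (no definitions), standard axioms, no sorries.  Memo
`run/shared/lean/prim/quant/prim-quant-arm-1-g40/CW-PRIMAL-G40.md` §8.  Supersedes, by the same architecture, this seat's criterion-E branch
(`…QuantGateMoveBlobGiantData`) and heavy-datum branch (`…QuantGateMoveBlobHeavyData`).

THE STATEMENT.  `0 < y < 1`, `0 ≤ z`, `y ≤ g ≤ 1`, `1 ≤ a`, `0 < S`; `ν = Σ_r λ_r·{lo_r, hi_r; γ_r}` an explicit datum at `(y, S, j, M)` each of whose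
charged components is `BValidAt y S j a` — typer g22/g23's validity WITHOUT LIGHT STRADDLERS (points, giant pairs, heavy credit pairs, and LIGHT credit
pairs `{lo, hi; γ}` only when BOTH copies stay below the layer, `hi + a ≤ j`) — and whose ZERO rides giants enough: `z ≤ Σ_{r : lo_r = 0, hi_r > j} λ_r(1−γ_r)`.
THEN `slice ν a g + g z (δ₀ − δ_a)` is `DECAtT y (S + ag − zag) j (M + a)` — the conclusion of the move lemma (M) / of `LawDec.WindowMixDEC` at the
layer `j`, from that layer ALONE.  For `z = 0` this is exactly typer g23's one-layer slice theorem `slice_decAtT_of_bdecAtT'` (the slice of a law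
with a straddler-free datum is DEC); the content here is the gate move, absorbed by the zero's giant components.
PROOF.  Component-wise (`decAtT_mixture_finset`): the moved mass `g z` is spread over the zero's GIANT components (`m_r = z λ_r(1−γ_r)/Z_G`); those
stay in the E-regime (`decAtT_movedGiantPair`, giant mass `γ_r ≥ y`); every other component is a one-component `BDECAtT` datum, so its slice is DEC at
`(y, S + ag, j)` by `slice_decAtT_of_bdecAtT'` and at `t = S + ag − zag ≤ S + ag` by antitonicity.
WHAT IS LEFT of CW after this file: light STRADDLERS in the partner's layer-`j` datum (`hi ≤ j < hi + a`, the `slCex` mechanism — needs the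
window) and the zero forced into mids while `z > 0` (needs cross-subsidy / another layer) — the dual route's `J < j` cases.
EXACT PRE-CHECK (`work/explore/cw_bdec.py`): 12 206 window-edge instances admitting a straddler-free layer-`j` datum with zero–giant mass `≥ z`
(`y` bisected to the edge of that feasibility), 0 failures of the conclusion.

* **`LawDec.decAtT_gateMoveBlob_of_bdecDatum`**, **`LawDec.windowMix_of_bdecDatum`** (the binder of `LawDec.WindowMixDEC`).

HONEST STATUS: `WindowMixDEC` (CW), `WindowMixSingleLayer`, `GateMove`, `GatedConvEmptyFree`, `SingleGateConvClosed`, `TreeDEC`, `FarTreeRow` OPEN;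
RATE class log\* / honest sentence of `run/shared/lean/prim/quant/README.md` UNCHANGED.

[this work]; `BDECAtT` / `slice_decAtT_of_bdecAtT'`: prim-quant-stmt g22–g23; mixtures: lead g30; `WindowMixDEC`: lead g31 (this lane).  Nothing here is
cited as a published result.  The gluing rows served [cite: KozmaNitzan2024, Conjecture 3 (p. 15)]; product measure [cite: Grimmett1999, §1.3 p. 10].
-/

noncomputable section

namespace Summit.CriticalPhenomena.PercolationContinuityZ3.Theorems

namespace Quant

open Finset

/-- the two-point law `{lo, hi; g}` (as in `…QuantLawDEC`) -/
local notation3 "TP[" lo ", " hi ", " g ", " h "]" =>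
  (g : ℝ) * (if (h : ℕ) = (hi : ℕ) then (1 : ℝ) else 0) + (1 - (g : ℝ)) * (if (h : ℕ) = (lo : ℕ) then (1 : ℝ) else 0)

namespace LawDec

/-- **THE BLOB GATE MOVE FROM A STRADDLER-FREE DATUM OF THE PARTNER AT ONE LAYER WHOSE ZERO RIDES GIANTS.**  See the module docstring.
[this work] -/
theorem decAtT_gateMoveBlob_of_bdecDatum {ρ : Type} [Fintype ρ] (y z g S : ℝ) (a j M : ℕ) (ν : ℕ → ℝ)
    (lam gg : ρ → ℝ) (lo hi : ρ → ℕ)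
    (hy0 : 0 < y) (hy1 : y < 1) (hz0 : 0 ≤ z) (hg1 : g ≤ 1) (hyg : y ≤ g) (ha : 1 ≤ a) (hS0 : 0 < S)
    (h0 : ∀ r, 0 ≤ lam r) (h1 : ∑ r, lam r = 1) (hgg : ∀ r, 0 ≤ gg r ∧ gg r ≤ 1) (hlohi : ∀ r, lo r ≤ hi r) (hhi : ∀ r, hi r ≤ M)
    (hν : ∀ h, ν h = ∑ r, lam r * TP[lo r, hi r, gg r, h])
    (hval : ∀ r, 0 < lam r → BValidAt y S j a (lo r) (hi r) (gg r))
    (hzero : z ≤ ∑ r, (if lo r = 0 ∧ j + 1 ≤ hi r then lam r * (1 - gg r) else 0)) :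
    DECAtT y (S + (a : ℝ) * g - z * (a : ℝ) * g) j (M + a)
      (fun h => slice ν a g h + g * z * ((if h = 0 then (1 : ℝ) else 0) - (if h = a then (1 : ℝ) else 0))) := by
  classical
  have hg0 : 0 ≤ g := hy0.le.trans hyg
  have ha0 : (0 : ℝ) < a := by exact_mod_cast (Nat.lt_of_lt_of_le Nat.zero_lt_one ha)
  set t : ℝ := S + (a : ℝ) * g - z * (a : ℝ) * g with ht
  have hta : t ≤ S + (a : ℝ) * g := by rw [ht]; nlinarith [mul_nonneg ha0.le hg0]
  set ZG : ℝ := ∑ r, (if lo r = 0 ∧ j + 1 ≤ hi r then lam r * (1 - gg r) else 0) with hZG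
  have hZG0 : 0 ≤ ZG := Finset.sum_nonneg fun r _ => by
    split_ifs
    · exact mul_nonneg (h0 r) (by linarith [(hgg r).2])
    · exact le_rfl
  -- the moved masses (as in `…QuantGateMoveBlobHeavyData`)
  set m : ρ → ℝ := fun r => if ZG = 0 then 0 else (if lo r = 0 ∧ j + 1 ≤ hi r then z * (lam r * (1 - gg r)) / ZG else 0) with hm
  have hm0 : ∀ r, 0 ≤ m r := fun r => by
    simp only [hm]; split_ifs
    · exact le_rfl
    · exact div_nonneg (mul_nonneg hz0 (mul_nonneg (h0 r) (by linarith [(hgg r).2]))) hZG0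
    · exact le_rfl
  have hmle : ∀ r, m r ≤ (if lo r = 0 ∧ j + 1 ≤ hi r then lam r * (1 - gg r) else 0) := fun r => by
    simp only [hm]
    by_cases hZ : ZG = 0
    · rw [if_pos hZ]; split_ifs; exacts [mul_nonneg (h0 r) (by linarith [(hgg r).2]), le_rfl]
    · rw [if_neg hZ]
      have hZpos : 0 < ZG := lt_of_le_of_ne hZG0 (Ne.symm hZ)
      split_ifs with hc
      · rw [div_le_iff₀ hZpos]
        have : z * (lam r * (1 - gg r)) ≤ ZG * (lam r * (1 - gg r)) :=
          mul_le_mul_of_nonneg_right hzero (mul_nonneg (h0 r) (by linarith [(hgg r).2]))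
        linarith
      · exact le_rfl
  have hmsum : ∑ r, m r = z := by
    simp only [hm]
    by_cases hZ : ZG = 0
    · simp only [if_pos hZ, Finset.sum_const_zero]
      have : z ≤ 0 := by rw [← hZ]; exact hzero
      linarith
    · simp only [if_neg hZ]
      have e : ∀ r, (if lo r = 0 ∧ j + 1 ≤ hi r then z * (lam r * (1 - gg r)) / ZG else 0)
          = (z / ZG) * (if lo r = 0 ∧ j + 1 ≤ hi r then lam r * (1 - gg r) else 0) := fun r => by
        split_ifs <;> ring
      rw [Finset.sum_congr rfl (fun r _ => e r), ← Finset.mul_sum, ← hZG, div_mul_cancel₀ _ hZ]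
  have hmlam : ∀ r, lam r = 0 → m r = 0 := fun r hr => by
    have := hmle r; rw [hr] at this
    have h2 : m r ≤ 0 := this.trans (by split_ifs <;> simp)
    exact le_antisymm h2 (hm0 r)
  -- the components
  set Q : ρ → ℕ → ℝ := fun r h => slice (fun k => TP[lo r, hi r, gg r, k]) a g h
      + g * (m r / lam r) * ((if h = 0 then (1 : ℝ) else 0) - (if h = a then (1 : ℝ) else 0)) with hQ
  have hP : ∀ h, slice ν a g h + g * z * ((if h = 0 then (1 : ℝ) else 0) - (if h = a then (1 : ℝ) else 0))
      = ∑ r, lam r * Q r h := by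
    intro h
    have e1 : slice ν a g h = ∑ r, lam r * slice (fun k => TP[lo r, hi r, gg r, k]) a g h := by
      have : ν = fun k => ∑ r, lam r * TP[lo r, hi r, gg r, k] := funext hν
      rw [this]; exact slice_sum_TP Finset.univ lam gg lo hi a g h
    have e2 : ∀ r, lam r * Q r h = lam r * slice (fun k => TP[lo r, hi r, gg r, k]) a g h
        + g * m r * ((if h = 0 then (1 : ℝ) else 0) - (if h = a then (1 : ℝ) else 0)) := by
      intro r
      simp only [hQ]
      by_cases hl : lam r = 0
      · rw [hl, hmlam r hl]; ring
      · rw [mul_add, show lam r * (g * (m r / lam r) * ((if h = 0 then (1 : ℝ) else 0) - (if h = a then (1 : ℝ) else 0)))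
            = g * (lam r * (m r / lam r)) * ((if h = 0 then (1 : ℝ) else 0) - (if h = a then (1 : ℝ) else 0)) by ring,
          mul_div_cancel₀ _ hl]
    rw [Finset.sum_congr rfl (fun r _ => e2 r), Finset.sum_add_distrib, ← e1]
    have e3 : ∑ r, g * m r * ((if h = 0 then (1 : ℝ) else 0) - (if h = a then (1 : ℝ) else 0))
        = g * (∑ r, m r) * ((if h = 0 then (1 : ℝ) else 0) - (if h = a then (1 : ℝ) else 0)) := by
      rw [Finset.mul_sum, Finset.sum_mul]
    rw [e3, hmsum]
  refine decAtT_congr (fun h => (hP h).symm) ?_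
  refine decAtT_mixture_finset Finset.univ lam Q (fun r _ => h0 r) h1 (fun r _ hr => ?_)
  by_cases hflag : lo r = 0 ∧ j + 1 ≤ hi r
  · -- a zero–giant component: E-regime with the move share
    have hG : lo r < hi r ∧ y ≤ gg r := by
      rcases hval r hr with (⟨heq, _⟩ | ⟨hlt, _, hyγ⟩ | ⟨_, hhij, _⟩) | ⟨_, hS⟩ | ⟨_, hha, _⟩
      · exfalso; omega
      · exact ⟨hlt, hyγ⟩
      · exfalso; omega
      · exfalso
        rcases hS with h2 | h2
        · rw [hflag.1] at h2; simp at h2; linarith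
        · omega
      · exfalso; omega
    have hmr : m r / lam r ≤ (if lo r = 0 then 1 - gg r else 0) := by
      rw [div_le_iff₀ hr, if_pos hflag.1]
      have := hmle r; rw [if_pos hflag] at this; linarith
    exact decAtT_movedGiantPair y t g (gg r) (m r / lam r) j M (lo r) (hi r) a hy0 hy1 hg0 hg1 ha hG.1 (hhi r) hflag.2 hG.2 (hgg r).2
      (div_nonneg (hm0 r) hr.le) hmr
  · -- any other component: no move share; a one-component straddler-free datum, sliced
    have hmr : m r = 0 := by
      have := hmle r; rw [if_neg hflag] at this; exact le_antisymm this (hm0 r)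
    have e : Q r = slice (fun k => TP[lo r, hi r, gg r, k]) a g := by
      funext h; simp only [hQ, hmr, zero_div, mul_zero, zero_mul, add_zero]
    rw [e]
    have hB : BDECAtT y S j M a (fun k => TP[lo r, hi r, gg r, k]) :=
      ⟨Unit, inferInstance, fun _ => 1, fun _ => gg r, fun _ => lo r, fun _ => hi r, fun _ => zero_le_one, by simp,
        fun _ => hgg r, fun _ => hlohi r, fun _ => hhi r, fun k => by simp, fun _ _ => hval r hr⟩
    exact decAtT_antitone_target hta (slice_decAtT_of_bdecAtT' y S g j M a _ hy0 hy1 hyg hg1 ha hB)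

/-- **the same in the binder of `LawDec.WindowMixDEC`** (conclusion law `(1−g)·ν + g·shiftBut ν a z`, target `S + ag(1−z)`). [this work] -/
theorem windowMix_of_bdecDatum {ρ : Type} [Fintype ρ] (y z g S : ℝ) (a j M : ℕ) (ν : ℕ → ℝ)
    (lam gg : ρ → ℝ) (lo hi : ρ → ℕ)
    (hy0 : 0 < y) (hy1 : y < 1) (hz0 : 0 ≤ z) (hg1 : g ≤ 1) (hyg : y ≤ g) (ha : 1 ≤ a) (hS0 : 0 < S)
    (h0 : ∀ r, 0 ≤ lam r) (h1 : ∑ r, lam r = 1) (hgg : ∀ r, 0 ≤ gg r ∧ gg r ≤ 1) (hlohi : ∀ r, lo r ≤ hi r) (hhi : ∀ r, hi r ≤ M)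
    (hν : ∀ h, ν h = ∑ r, lam r * TP[lo r, hi r, gg r, h])
    (hval : ∀ r, 0 < lam r → BValidAt y S j a (lo r) (hi r) (gg r))
    (hzero : z ≤ ∑ r, (if lo r = 0 ∧ j + 1 ≤ hi r then lam r * (1 - gg r) else 0)) :
    DECAtT y (S + (a : ℝ) * g * (1 - z)) j (M + a) (fun h => (1 - g) * ν h + g * shiftBut ν a z h) := by
  have e : (fun h => (1 - g) * ν h + g * shiftBut ν a z h)
      = fun h => slice ν a g h + g * z * ((if h = 0 then (1 : ℝ) else 0) - (if h = a then (1 : ℝ) else 0)) :=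
    funext fun h => windowMix_eq_slice_add ν a g z h
  rw [e, show S + (a : ℝ) * g * (1 - z) = S + (a : ℝ) * g - z * (a : ℝ) * g by ring]
  exact decAtT_gateMoveBlob_of_bdecDatum y z g S a j M ν lam gg lo hi hy0 hy1 hz0 hg1 hyg ha hS0 h0 h1 hgg hlohi hhi hν hval hzero

end LawDec

end Quant

end Summit.CriticalPhenomena.PercolationContinuityZ3.Theorems
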